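import Mathlib

/-!
# ζ(5) search — DENOM-LAW D2: deep-cell lemmas for the threshold model (denom-engine-d2 g11, THRESHOLD-X3; filed verbatim in five parts ≤ 400 lines by denom-prover-d1 g5, K1 item (1) «ThresholdModel port» — this is part 1: indicators, counts, the model, `DeepCell`)

Cell `pub-zeta5`, track DENOM-LAW.  HONEST FRAMING: systematic search; MODEL/structure side — elementary linear
inequalities about the level/class combinatorics of Brown–Zudilin cells in the ρ-coordinates of
`denom-law/engine-d2/g10/THRESHOLD-X2.md` (theory-d1 g9's Theorem S / `theory-d1g9/lean/SelectionTable.lean`);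
nothing about ζ(5); no γ; no p-adic digit, no linear form, no kernel value; no irrationality claim; records in print UNMOVED.

## Setting (all integers).  A D cell of octave `m ≥ 1` at the odd prime `p` is `b = (b₀; b₁ ≥ … ≥ b₇)` with point digits
`⌊b_j/p⌋ ∈ {m−1, m}`, pair digits `⌊(b₀−b_j−b_k)/p⌋ ∈ {m−1, m}` and `⌊(3b₀ − Σ b_j)/p⌋ = 2m`.  Put
`ρ_j := b₀ − 2b_j − (m−1)p` (ascending: `r 0 ≤ … ≤ r 6` below) and `R₀ := b₀ − (3m−2)p`.  Then (two-line translations,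
THRESHOLD-X2 §1/§5): point digits ⟺ `R₀ − 3p + 2 ≤ ρ_j ≤ R₀ + p`; pair digits ⟺ `0 ≤ ρ_j + ρ_k ≤ 4p − 2`; `b_j ≥ mp ⟺ ρ_j ≤ R₀ − p`;
pair digit `= m−1 ⟺ ρ_j + ρ_k < 2p`; `ρ_j ≡ R₀ + 1 (mod 2)`; the residue classes of the cell are the `p` integers `u ∈ (−p, p]`
with `u ≡ R₀ (mod 2)` (`u` = theory-d1's census offset = the engine's `ut`); the self-mirror («centre») class is `u ∈ {0, p}`.
The DEEP condition of engine-d2 g8/g9 (`a = #{j : b_j ≥ mp} ∈ {0,1,2}`, `λ_j = #{k > j : pair digit (j,k) = m−1}`,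
`λ ≤ (3,1), (2,1), (2)` for `a = 0, 1, 2`) reads, for ascending ρ:  a = 0: `R₀−p < ρ₁`, `ρ₁+ρ₅ ≥ 2p`, `ρ₂+ρ₄ ≥ 2p`, `ρ₃+ρ₄ ≥ 2p`;
a = 1: `ρ₁ ≤ R₀−p < ρ₂`, `ρ₁+ρ₄ ≥ 2p`, `ρ₂+ρ₄ ≥ 2p`, `ρ₃+ρ₄ ≥ 2p`;  a = 2: `ρ₂ ≤ R₀−p < ρ₃`, `ρ₁+ρ₄ ≥ 2p`, `ρ₂+ρ₃ ≥ 2p`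
(`λ_j` counts an initial segment of `k > j` because ρ is ascending; `isDeepCount_iff` below proves the equivalence, and
`code/d2g11/explore2.py` re-checks it on the 138,384 cells of the exhaustive blocks (1,11), (1,13), (2,13), (3,13), (1,17), (1,19)
and g10's F2).  THRESHOLD MODEL (Theorem S (i)): the class `u` has root type
`L(u) = #{j : ρ_j < u+p}`, `R(u) = #{j : ρ_j < p−u}`, `n₊(u) = [u ≥ 2p−R₀]`, `n₋(u) = [u ≤ R₀−2p]`, defect `δ = L+R+n₊+n₋`,
and the DOMINANT classes are `argmin_u (δ(u) + [u ∈ {0,p}])` (engine weight; THRESHOLD-X2 §1).  At `m = 1` the type is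
AMENDED (A1/A2, THRESHOLD-X2 §0 / SELECTION-LAW-PROOF v3 §5): `L − [u > R₀]`, `R − [u < −R₀]`, `n₊ − #{j : ρ_j ≥ 3p−u}`,
`n₋ − #{j : ρ_j ≥ 3p+u}`; for `m ≥ 2` a class with `|u| > R₀` or some `ρ_j ≥ 3p ∓ u` is NON-ADMISSIBLE.

## What is proved here (kernel-checked, `omega`/`linarith` after order-statistic bridging lemmas), for every `DeepCell p R₀ r`:
* `box` — THE BOX of Theorem S is a CONSEQUENCE of deep + digits: `1 ≤ ρ_j` for all j, `0 ≤ R₀ ≤ 3p − 2`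
  (sealed claim S1 of P-D2-SELECTION, 256,039/256,039, now a three-line theorem); `BCell.box` says it for a cell given by `b`.
* `admissible_m1` — every m = 1 class is admissible: the four amended exponents are `≥ 0` (S2a; SELECTION-LAW-PROOF v3 §5 «NOT proved here»).
* `utStar_isClass`, `score_utStar_le_four` — the explicit class `u* = p − ρ₁` (if `ρ₁ < p`), else `u* ∈ {0,1}` by parity of R₀,
  has `δ(u*) + [centre] ≤ 4`; hence `dominant_delta_le_four` / `dominantA_delta_le_four`: NO class of defect `δ ≥ 5` («ζ⁵ class»)
  is ever dominant on a deep cell (THRESHOLD-X2 §5, observed 0/256,039, «write-up left to you»); tight (`exRho`: a dominant δ = 4).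
* `six_le_deltaA_of_A2`, `five_le_deltaA_of_A1`, `not_dominantA_of_A1A2`, `not_dominant_of_nonadmissible` — an A1/A2 class
  (m = 1), resp. a non-admissible class (m ≥ 2), has (amended) defect ≥ 5 and is NEVER dominant (S3b; THRESHOLD-X2 «observed 0»).
* `L_step`, `R_step`, `np_step`, `nm_step`, `delta_step` — the exact event formulas between adjacent same-side classes `u → u+2`;
  `one_move` — on a deep cell `up ≥ 2 ∧ down ≥ 2` is impossible for `u ≥ 0`; `adjacent_equal_delta_moves_le_one` — S4c as stated
  (THRESHOLD-X2 §4: the adjacent ONE-MOVE law is a theorem of the deep condition; `rimRho`: the non-deep control cell with `up = down = 2`).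
* `R_le_L`, `nm_le_np`, `L_mono`, `R_anti`, `np_mono`, `nm_anti` (Theorem S (ii)/(iii) in these coordinates), `delta_neg`,
  `score_neg`, `isDominant_neg` (mirror symmetry, S3c), `isDeepCount_iff` / `DeepCell.of_count` (the counting form of DEEP as
  enumerated by `code/d2g9/exhaust.py` ⟺ the inequality form), `BCell.deepCell` (dictionary `b ↦ (ρ, R₀)` with `q = (m−1)p`:
  the octave enters only through `q` — octave invariance is manifest).
Not used (hence not assumed): the `fd = 2m` window `R₀ + 5p ≤ Σρ_j ≤ R₀ + 7p − 2`, BZ's polytope extras, primality of p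
(only `p` odd, `p ≥ 3`).  What is NOT here: the census itself (classes ↔ levels ↔ Pochhammer blocks = Theorem S (i), theory-d1's
bookkeeping and level inequalities), the unit-Plücker table (theory-d1's `SelectionTable.lean`), anything p-adic.
-/

namespace Summit.KontsevichZagierPeriods.Zeta5Search.DenomLaw.ThresholdModel.Rho

/-! ## Indicators and order-statistic counts over the seven blocks -/

/-- integer indicator of a decidable proposition. -/
def indic (c : Prop) [Decidable c] : ℤ := if c then 1 else 0

/-- The indicator of a true proposition is `1`. -/
theorem indic_pos {c : Prop} [Decidable c] (h : c) : indic c = 1 := by simp [indic, h]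
/-- The indicator of a false proposition is `0`. -/
theorem indic_neg {c : Prop} [Decidable c] (h : ¬ c) : indic c = 0 := by simp [indic, h]
/-- Indicators are non-negative. -/
theorem indic_nonneg (c : Prop) [Decidable c] : 0 ≤ indic c := by unfold indic; split_ifs <;> norm_num
/-- Indicators are at most `1`. -/
theorem indic_le_one (c : Prop) [Decidable c] : indic c ≤ 1 := by unfold indic; split_ifs <;> norm_num
/-- Indicators are monotone along implication. -/
theorem indic_mono {c d : Prop} [Decidable c] [Decidable d] (h : c → d) : indic c ≤ indic d := by
  unfold indic; split_ifs <;> simp_all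
/-- Indicators of equivalent propositions agree. -/
theorem indic_congr {c d : Prop} [Decidable c] [Decidable d] (h : c ↔ d) : indic c = indic d := by
  unfold indic
  by_cases hd : d
  · simp [hd, h.2 hd]
  · simp [hd, mt h.1 hd]

/-- `#{j : r j < T}` -/
def countLt (r : Fin 7 → ℤ) (T : ℤ) : ℤ := ∑ j : Fin 7, indic (r j < T)
/-- `#{j : T ≤ r j}` -/
def countGe (r : Fin 7 → ℤ) (T : ℤ) : ℤ := ∑ j : Fin 7, indic (T ≤ r j)
/-- `#{j : r j = v}` -/
def countEq (r : Fin 7 → ℤ) (v : ℤ) : ℤ := ∑ j : Fin 7, indic (r j = v)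
/-- `#{j : r j ≤ T}` -/
def countLe (r : Fin 7 → ℤ) (T : ℤ) : ℤ := ∑ j : Fin 7, indic (r j ≤ T)

/-- the counts are literally cardinalities of filters of the block index set (the form used in theory-d1's sketch). -/
theorem countLt_eq_card (r : Fin 7 → ℤ) (T : ℤ) :
    countLt r T = ((Finset.univ.filter fun j => r j < T).card : ℤ) := by
  unfold countLt indic
  rw [Finset.card_filter]
  push_cast
  rfl

/-- `#{j : j < k} = k` for `k ≤ 7`. -/
theorem sum_indic_lt_nat (k : ℕ) (hk : k ≤ 7) : (∑ j : Fin 7, indic ((j : ℕ) < k)) = k := by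
  interval_cases k <;> simp only [Fin.sum_univ_seven] <;> decide

/-- `countLt` is non-negative. -/
theorem countLt_nonneg (r : Fin 7 → ℤ) (T : ℤ) : 0 ≤ countLt r T :=
  Finset.sum_nonneg fun _ _ => indic_nonneg _
/-- `countGe` is non-negative. -/
theorem countGe_nonneg (r : Fin 7 → ℤ) (T : ℤ) : 0 ≤ countGe r T :=
  Finset.sum_nonneg fun _ _ => indic_nonneg _
/-- `countEq` is non-negative. -/
theorem countEq_nonneg (r : Fin 7 → ℤ) (v : ℤ) : 0 ≤ countEq r v :=
  Finset.sum_nonneg fun _ _ => indic_nonneg _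

/-- `countLt ≤ 7`. -/
theorem countLt_le_seven (r : Fin 7 → ℤ) (T : ℤ) : countLt r T ≤ 7 := by
  unfold countLt
  calc (∑ j : Fin 7, indic (r j < T)) ≤ ∑ _j : Fin 7, (1 : ℤ) := Finset.sum_le_sum fun j _ => indic_le_one _
    _ = 7 := by simp

/-- sorted blocks: if `T ≤ r k` then at most `k` blocks lie below `T`. -/
theorem countLt_le {r : Fin 7 → ℤ} (hr : Monotone r) (k : Fin 7) {T : ℤ} (h : T ≤ r k) :
    countLt r T ≤ k := by
  unfold countLt
  calc (∑ j : Fin 7, indic (r j < T)) ≤ ∑ j : Fin 7, indic ((j : ℕ) < (k : ℕ)) := by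
        apply Finset.sum_le_sum
        intro j _
        apply indic_mono
        intro hj
        by_contra hjk
        have hkj : (k : ℕ) ≤ j := not_lt.1 hjk
        have : r k ≤ r j := hr (Fin.le_iff_val_le_val.2 hkj)
        linarith
    _ = (k : ℕ) := sum_indic_lt_nat k (by omega)

/-- sorted blocks: if `r k < T` then at least `k+1` blocks lie below `T`. -/
theorem countLt_ge {r : Fin 7 → ℤ} (hr : Monotone r) (k : Fin 7) {T : ℤ} (h : r k < T) :
    (k : ℤ) + 1 ≤ countLt r T := by
  unfold countLt
  calc ((k : ℕ) : ℤ) + 1 = ∑ j : Fin 7, indic ((j : ℕ) < (k : ℕ) + 1) := by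
        have := sum_indic_lt_nat ((k : ℕ) + 1) (by omega)
        push_cast at this ⊢
        linarith
    _ ≤ ∑ j : Fin 7, indic (r j < T) := by
        apply Finset.sum_le_sum
        intro j _
        apply indic_mono
        intro hj
        have : r j ≤ r k := hr (Fin.le_iff_val_le_val.2 (by omega))
        linarith

/-- sorted blocks: if `T < r k` then at most `k` blocks are `≤ T`. -/
theorem countLe_le {r : Fin 7 → ℤ} (hr : Monotone r) (k : Fin 7) {T : ℤ} (h : T < r k) :
    countLe r T ≤ k := by
  unfold countLe
  calc (∑ j : Fin 7, indic (r j ≤ T)) ≤ ∑ j : Fin 7, indic ((j : ℕ) < (k : ℕ)) := by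
        apply Finset.sum_le_sum
        intro j _
        apply indic_mono
        intro hj
        by_contra hjk
        have hkj : (k : ℕ) ≤ j := not_lt.1 hjk
        have : r k ≤ r j := hr (Fin.le_iff_val_le_val.2 hkj)
        linarith
    _ = (k : ℕ) := sum_indic_lt_nat k (by omega)

/-- sorted blocks: if `r k < T` then at most `6 − k` blocks are `≥ T`. -/
theorem countGe_le {r : Fin 7 → ℤ} (hr : Monotone r) (k : Fin 7) {T : ℤ} (h : r k < T) :
    countGe r T ≤ 6 - k := by
  unfold countGe
  have e : ∀ j : Fin 7, indic (T ≤ r j) = 1 - indic (r j < T) := by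
    intro j; unfold indic; split_ifs <;> omega
  simp only [e, Finset.sum_sub_distrib, Finset.sum_const, Finset.card_univ, Fintype.card_fin, nsmul_eq_mul,
    mul_one]
  have := countLt_ge hr k h
  unfold countLt at this
  push_cast at this ⊢
  linarith

/-- sorted blocks: if some block is `≥ T` then the top block is. -/
theorem top_ge_of_countGe_pos {r : Fin 7 → ℤ} (hr : Monotone r) {T : ℤ} (h : 1 ≤ countGe r T) : T ≤ r 6 := by
  by_contra h6
  have := countGe_le hr 6 (not_le.1 h6)
  simp at this
  linarith

/-- `#{r j = v} ≤ #{r j ≤ v}`. -/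
theorem countEq_le_countLe (r : Fin 7 → ℤ) (v : ℤ) : countEq r v ≤ countLe r v :=
  Finset.sum_le_sum fun _ _ => indic_mono fun h => h.le

/-- for `v₁ < v₂`: `#{r j = v₁} + #{r j = v₂} ≤ #{r j ≤ v₂}`. -/
theorem countEq_add_countEq_le (r : Fin 7 → ℤ) {v₁ v₂ : ℤ} (hv : v₁ < v₂) :
    countEq r v₁ + countEq r v₂ ≤ countLe r v₂ := by
  unfold countEq countLe
  rw [← Finset.sum_add_distrib]
  apply Finset.sum_le_sum
  intro j _
  unfold indic; split_ifs <;> omega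

/-! ## The threshold model in ρ-coordinates -/

section Model
variable (p R0 : ℤ) (r : Fin 7 → ℤ) (u : ℤ)

/-- `L(u) = #{j : u > −a_j} = #{j : ρ_j < u + p}` — multiplicity of the root `−m/2`. -/
def L : ℤ := countLt r (u + p)
/-- `R(u) = #{j : u < a_j} = #{j : ρ_j < p − u}` — multiplicity of the root `+m/2`. -/
def R : ℤ := countLt r (p - u)
/-- `n₊(u) = [u ≥ A]`, `A = 2p − R₀` — the extra numerator zero at `+3m/2`. -/
def np : ℤ := indic (2 * p - R0 ≤ u)
/-- `n₋(u) = [u ≤ −A]` — the extra numerator zero at `−3m/2`. -/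
def nm : ℤ := indic (u ≤ R0 - 2 * p)
/-- the defect `δ(u) = L + R + n₊ + n₋` (degree of the class polynomial; threshold model, un-amended). -/
def delta : ℤ := L p r u + R p r u + np p R0 u + nm p R0 u
/-- the engine's centre weight: the self-mirror class `u ∈ {0, p}` carries one extra factor `p`. -/
def centre : ℤ := indic (u = 0 ∨ u = p)
/-- dominance score `δ(u) + [centre]`; the dominant classes are its argmin (THRESHOLD-X2 §1, DOMINANCE LAW). -/
def score : ℤ := delta p R0 r u + centre p u
/-- the residue classes of the cell: `u ∈ (−p, p]`, `u ≡ R₀ (mod 2)`. -/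
def IsClass : Prop := -p < u ∧ u ≤ p ∧ (u - R0) % 2 = 0
/-- `u` is a dominant class (un-amended score; the `m ≥ 2` regime). -/
def IsDominant : Prop := IsClass p R0 u ∧ ∀ u', IsClass p R0 u' → score p R0 r u ≤ score p R0 r u'

/-- blocks reaching the level beyond the pole frame on the right: `#{j : ρ_j ≥ 3p − u}` (A1 / «pole-right-of-frame»). -/
def reachR : ℤ := countGe r (3 * p - u)
/-- blocks reaching the level beyond the pole frame on the left: `#{j : ρ_j ≥ 3p + u}`. -/
def reachL : ℤ := countGe r (3 * p + u)
/-- m = 1 amended `L` (A2): `L − [u > R₀]`. -/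
def LA : ℤ := L p r u - indic (R0 < u)
/-- m = 1 amended `R` (A2): `R − [u < −R₀]`. -/
def RA : ℤ := R p r u - indic (u < -R0)
/-- m = 1 amended `n₊` (A1): `[u ≥ A] − #{j : ρ_j ≥ 3p − u}`. -/
def npA : ℤ := np p R0 u - reachR p r u
/-- m = 1 amended `n₋` (A1): `[u ≤ −A] − #{j : ρ_j ≥ 3p + u}`. -/
def nmA : ℤ := nm p R0 u - reachL p r u
/-- m = 1 amended defect. -/
def deltaA : ℤ := LA p R0 r u + RA p R0 r u + npA p R0 r u + nmA p R0 r u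
/-- m = 1 amended dominance score. -/
def scoreA : ℤ := deltaA p R0 r u + centre p u
/-- `u` is a dominant class for the amended score (the `m = 1` regime). -/
def IsDominantA : Prop := IsClass p R0 u ∧ ∀ u', IsClass p R0 u' → scoreA p R0 r u ≤ scoreA p R0 r u'

/-- roots gained between the adjacent same-side classes `u → u+2`: `#{j : ρ_j = u+p} + [R₀ = 2p−u−2]`. -/
def up : ℤ := countEq r (u + p) + indic (R0 = 2 * p - u - 2)
/-- roots lost between `u → u+2`: `#{j : ρ_j = p−u−2} + [R₀ = 2p+u]`. -/
def down : ℤ := countEq r (p - u - 2) + indic (R0 = 2 * p + u)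

/-- the explicit witness class: `u* = p − ρ₁` if `ρ₁ < p`, else `0` or `1` by the parity of `R₀`. -/
def utStar : ℤ := if r 0 < p then p - r 0 else if R0 % 2 = 0 then 0 else 1

end Model

/-- A DEEP D CELL in ρ-coordinates (see the module docstring for the dictionary with `b`). -/
structure DeepCell (p R0 : ℤ) (r : Fin 7 → ℤ) : Prop where
  odd_p : p % 2 = 1
  three_le_p : 3 ≤ p
  mono : Monotone r
  parity : ∀ j, (r j - R0) % 2 = 1
  point_lo : ∀ j, R0 - 3 * p + 2 ≤ r j
  point_hi : ∀ j, r j ≤ R0 + p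
  pair_lo : 0 ≤ r 0 + r 1
  pair_hi : r 5 + r 6 ≤ 4 * p - 2
  deep : (R0 - p < r 0 ∧ 2 * p ≤ r 0 + r 4 ∧ 2 * p ≤ r 1 + r 3 ∧ 2 * p ≤ r 2 + r 3) ∨
         (r 0 ≤ R0 - p ∧ R0 - p < r 1 ∧ 2 * p ≤ r 0 + r 3 ∧ 2 * p ≤ r 1 + r 3 ∧ 2 * p ≤ r 2 + r 3) ∨
         (r 1 ≤ R0 - p ∧ R0 - p < r 2 ∧ 2 * p ≤ r 0 + r 3 ∧ 2 * p ≤ r 1 + r 2)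

end Summit.KontsevichZagierPeriods.Zeta5Search.DenomLaw.ThresholdModel.Rho
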